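import Mathlib
import HarnessLib
import Summits.NavierStokesRegularity.NavierStokesRegularity.Theorems.ChiralWindowDoorDefs
import Summits.NavierStokesRegularity.NavierStokesRegularity.Theorems.CriticalFluxDoorDefs
import Summits.NavierStokesRegularity.NavierStokesRegularity.Theorems.ChiralWindowDoorClassDerivDecay
import Summits.NavierStokesRegularity.NavierStokesRegularity.Theorems.CriticalFluxDoorLambdaDeriv

/-!
# Door S21-C «CriticalFluxDoor» — INTEGRATION BY PARTS AGAINST A VECTOR FIELD and F3's PRESSURE FLUX (F3 plumbing E10, E11)

Door S21-C of nsreg-p1's local Type-I door family (`HOME/ns-regularity-ideate-p1/ROUND-20.md`; DESIGN-ONLY, route NOT born).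
The pressure term of the windowed critical-energy budget (F3-DERIVATION §1): `−2∫a⟨∇p, Λv⟩ = 2∫p ∇a·Λv`, gauge-free since
`∫∇a·Λv = −∫a div Λv = 0`.

* E10 `clm_apply_eq_sum`, `divergence_eq_sum`, `fderiv_coord_apply`, `integral_mul_fderiv_apply_eq_neg` (**`∫ a·Dp(w) =
  −∫ p·(Da(w) + a·div w)`** for `a ∈ C¹_c`, `p ∈ C¹`, `w` differentiable with continuous partials; coordinatewise Mathlib
  `integral_mul_fderiv_eq_neg_fderiv_mul_of_integrable`), `integral_mul_fderiv_apply_eq_neg_of_divFree`,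
  `integral_fderiv_apply_eq_zero_of_divFree`;
* E11 `bounds_fderiv_apply`, `fracLapHalf_slice_regular` (door-class `Λ(v s)`: differentiable, continuous partials, divergence
  free), `integral_mul_fderiv_apply_fracLapHalf_slice` (**F3's pressure flux `∫a⟨Dp, Λv(s)⟩ = −∫p⟨Da, Λv(s)⟩`**) and
  `integral_fderiv_apply_fracLapHalf_slice_eq_zero` (its gauge-freeness).

Proofs: nsreg-p1 g17 (`r20/LambdaDecay.lean` v5 §§E10, E11, farm rc 0), landed by nsreg-p6 g13.  Seat nsreg-p6 g13 (THEOREMS-ONLY door sequels, DIRECTOR-NS g8 #32 (2)/#36).  WHAT THIS IS NOT: not NS regularity (Clay A); calculus only; no route is opened.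
-/

noncomputable section

-- the summit and its single sub-problem share the name (CONVENTIONS §1), as in every Theorems file
set_option linter.dupNamespace false

namespace Summit.NavierStokesRegularity.NavierStokesRegularity.Theorems.CriticalFluxDoorPressureIBP

open MeasureTheory Metric Set Filter Topology Function
open Literature.Analysis Literature.Analysis.FluidPDE
open Summit.NavierStokesRegularity.NavierStokesRegularity.Theorems.ChiralWindowDoorDefs
open Summit.NavierStokesRegularity.NavierStokesRegularity.Theorems.CriticalFluxDoorDefs
open Summit.NavierStokesRegularity.NavierStokesRegularity.Theorems.ChiralWindowDoorClassDerivDecay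
open Summit.NavierStokesRegularity.NavierStokesRegularity.Theorems.CriticalFluxDoorLambdaDeriv

/-! ## E10 — INTEGRATION BY PARTS AGAINST A VECTOR FIELD: `∫a⟨Dp,w⟩ = −∫p(⟨Da,w⟩ + a·div w)` for `a ∈ C¹_c`,
`p ∈ C¹`, `w` differentiable with continuous partials; for divergence-free `w` the pressure flux of F3
(`∫a_R⟨∇p,Λv⟩ = −∫p⟨∇a_R,Λv⟩`) and its gauge-freeness (`∫⟨∇a_R,Λv⟩ = 0`, `p ≡ 1`). -/

/-- coordinates: `L u = Σᵢ uᵢ·L(eᵢ)` for a linear functional on `EuclideanSpace ℝ (Fin 3)`. -/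
theorem clm_apply_eq_sum (L : EuclideanSpace ℝ (Fin 3) →L[ℝ] ℝ) (u : EuclideanSpace ℝ (Fin 3)) :
    L u = ∑ i, u i * L (EuclideanSpace.single i 1) := by
  conv_lhs => rw [← (EuclideanSpace.basisFun (Fin 3) ℝ).sum_repr u]
  simp only [map_sum, map_smul, smul_eq_mul, EuclideanSpace.basisFun_apply, EuclideanSpace.basisFun_repr]

/-- the divergence in coordinates: `div w(x) = Σᵢ (Dw(x)eᵢ)ᵢ`. -/
theorem divergence_eq_sum (w : EuclideanSpace ℝ (Fin 3) → EuclideanSpace ℝ (Fin 3)) (x : EuclideanSpace ℝ (Fin 3)) :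
    VectorCalculus.divergence w x = ∑ i, (fderiv ℝ w x (EuclideanSpace.single i 1)) i := by
  unfold VectorCalculus.divergence
  rw [LinearMap.trace_eq_sum_inner _ (EuclideanSpace.basisFun (Fin 3) ℝ)]
  refine Finset.sum_congr rfl fun i _ => ?_
  rw [EuclideanSpace.basisFun_apply, ContinuousLinearMap.coe_coe, EuclideanSpace.inner_single_left]
  simp

/-- components of the derivative: `D(wᵢ)(x)u = (Dw(x)u)ᵢ`. -/
theorem fderiv_coord_apply {w : EuclideanSpace ℝ (Fin 3) → EuclideanSpace ℝ (Fin 3)} {x : EuclideanSpace ℝ (Fin 3)} (hw : DifferentiableAt ℝ w x) (i : Fin 3) (u : EuclideanSpace ℝ (Fin 3)) :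
    fderiv ℝ (fun y => w y i) x u = (fderiv ℝ w x u) i := by
  have h := ((EuclideanSpace.proj i : EuclideanSpace ℝ (Fin 3) →L[ℝ] ℝ).hasFDerivAt.comp x hw.hasFDerivAt)
  rw [show (fun y => w y i) = (EuclideanSpace.proj i : EuclideanSpace ℝ (Fin 3) →L[ℝ] ℝ) ∘ w from rfl, h.fderiv]
  rfl

/-- **Integration by parts against a vector field**: `∫ a·Dp(w) = −∫ p·(Da(w) + a·div w)` for `a ∈ C¹` compactly
supported, `p ∈ C¹`, `w` differentiable with continuous directional derivatives `x ↦ Dw(x)eᵢ`. -/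
theorem integral_mul_fderiv_apply_eq_neg {a p : EuclideanSpace ℝ (Fin 3) → ℝ} {w : EuclideanSpace ℝ (Fin 3) → EuclideanSpace ℝ (Fin 3)} (ha : ContDiff ℝ 1 a)
    (hac : HasCompactSupport a) (hp : ContDiff ℝ 1 p) (hw : Differentiable ℝ w)
    (hwc : ∀ i : Fin 3, Continuous fun x => fderiv ℝ w x (EuclideanSpace.single i 1)) :
    ∫ x, a x * fderiv ℝ p x (w x) =
      - ∫ x, p x * (fderiv ℝ a x (w x) + a x * VectorCalculus.divergence w x) := by
  have hacn : Continuous a := ha.continuous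
  have hpcn : Continuous p := hp.continuous
  have hwcn : Continuous w := hw.continuous
  have had : Differentiable ℝ a := ha.differentiable one_ne_zero
  have hpd : Differentiable ℝ p := hp.differentiable one_ne_zero
  have hDa : Continuous (fderiv ℝ a) := ha.continuous_fderiv one_ne_zero
  have hDp : Continuous (fderiv ℝ p) := hp.continuous_fderiv one_ne_zero
  -- coordinate functions of `w`
  have hwi : ∀ i : Fin 3, Differentiable ℝ (fun y => w y i) := fun i =>
    (EuclideanSpace.proj i : EuclideanSpace ℝ (Fin 3) →L[ℝ] ℝ).differentiable.comp hw
  have hwic : ∀ i : Fin 3, Continuous (fun y => w y i) := fun i => (hwi i).continuous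
  have hDwi : ∀ i : Fin 3, Continuous (fun x => fderiv ℝ (fun y => w y i) x (EuclideanSpace.single i 1)) := by
    intro i
    have : (fun x => fderiv ℝ (fun y => w y i) x (EuclideanSpace.single i 1)) =
        fun x => (fderiv ℝ w x (EuclideanSpace.single i 1)) i := by
      funext x; exact fderiv_coord_apply (hw x) i _
    rw [this]
    exact (EuclideanSpace.proj i : EuclideanSpace ℝ (Fin 3) →L[ℝ] ℝ).continuous.comp (hwc i)
  -- continuity of `x ↦ Da(x)eᵢ`, `x ↦ Dp(x)eᵢ`
  have hDai : ∀ i : Fin 3, Continuous fun x => fderiv ℝ a x (EuclideanSpace.single i 1) := fun i =>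
    hDa.clm_apply continuous_const
  have hDpi : ∀ i : Fin 3, Continuous fun x => fderiv ℝ p x (EuclideanSpace.single i 1) := fun i =>
    hDp.clm_apply continuous_const
  -- per-coordinate integration by parts
  have hIBP : ∀ i : Fin 3,
      ∫ x, (a x * w x i) * fderiv ℝ p x (EuclideanSpace.single i 1) =
        - ∫ x, (fderiv ℝ a x (EuclideanSpace.single i 1) * w x i +
            a x * fderiv ℝ (fun y => w y i) x (EuclideanSpace.single i 1)) * p x := by
    intro i
    have hprod : ∀ x, fderiv ℝ (fun y => a y * w y i) x (EuclideanSpace.single i 1) =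
        fderiv ℝ a x (EuclideanSpace.single i 1) * w x i +
          a x * fderiv ℝ (fun y => w y i) x (EuclideanSpace.single i 1) := by
      intro x
      rw [fderiv_fun_mul (had x) (hwi i x)]
      simp only [add_apply, smul_apply, smul_eq_mul]
      ring
    have hsupp : HasCompactSupport (fun y => a y * w y i) := hac.mul_right
    have hf'g : Integrable (fun x => fderiv ℝ (fun y => a y * w y i) x (EuclideanSpace.single i 1) * p x) := by
      have hc : Continuous (fun x => fderiv ℝ (fun y => a y * w y i) x (EuclideanSpace.single i 1) * p x) := by
        simp_rw [hprod]
        exact (((hDai i).mul (hwic i)).add (hacn.mul (hDwi i))).mul hpcn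
      refine hc.integrable_of_hasCompactSupport ?_
      exact (hsupp.fderiv_apply (𝕜 := ℝ) (EuclideanSpace.single i 1)).mul_right
    have hfg' : Integrable (fun x => (a x * w x i) * fderiv ℝ p x (EuclideanSpace.single i 1)) :=
      (((hacn.mul (hwic i)).mul (hDpi i))).integrable_of_hasCompactSupport hsupp.mul_right
    have hfg : Integrable (fun x => (a x * w x i) * p x) :=
      ((hacn.mul (hwic i)).mul hpcn).integrable_of_hasCompactSupport hsupp.mul_right
    rw [integral_mul_fderiv_eq_neg_fderiv_mul_of_integrable hf'g hfg' hfg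
      (fun x _ => (had x).mul (hwi i x)) (fun x _ => hpd x)]
    simp_rw [hprod]
  -- expand both sides in coordinates and sum
  have hL : ∀ x, a x * fderiv ℝ p x (w x) =
      ∑ i, (a x * w x i) * fderiv ℝ p x (EuclideanSpace.single i 1) := fun x => by
    rw [clm_apply_eq_sum (fderiv ℝ p x) (w x), Finset.mul_sum]
    refine Finset.sum_congr rfl fun i _ => ?_; ring
  have hR : ∀ x, p x * (fderiv ℝ a x (w x) + a x * VectorCalculus.divergence w x) =
      ∑ i, (fderiv ℝ a x (EuclideanSpace.single i 1) * w x i +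
        a x * fderiv ℝ (fun y => w y i) x (EuclideanSpace.single i 1)) * p x := fun x => by
    rw [clm_apply_eq_sum (fderiv ℝ a x) (w x), divergence_eq_sum, Finset.mul_sum, ← Finset.sum_add_distrib,
      Finset.mul_sum]
    refine Finset.sum_congr rfl fun i _ => ?_
    rw [fderiv_coord_apply (hw x) i]
    ring
  have hLi : ∀ i : Fin 3, Integrable (fun x => (a x * w x i) * fderiv ℝ p x (EuclideanSpace.single i 1)) :=
    fun i => (((hacn.mul (hwic i)).mul (hDpi i))).integrable_of_hasCompactSupport (hac.mul_right).mul_right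
  have hRi : ∀ i : Fin 3, Integrable (fun x => (fderiv ℝ a x (EuclideanSpace.single i 1) * w x i +
      a x * fderiv ℝ (fun y => w y i) x (EuclideanSpace.single i 1)) * p x) := by
    intro i
    have hc : Continuous (fun x => (fderiv ℝ a x (EuclideanSpace.single i 1) * w x i +
        a x * fderiv ℝ (fun y => w y i) x (EuclideanSpace.single i 1)) * p x) :=
      (((hDai i).mul (hwic i)).add (hacn.mul (hDwi i))).mul hpcn
    refine hc.integrable_of_hasCompactSupport ?_
    exact (((hac.fderiv_apply (𝕜 := ℝ) (EuclideanSpace.single i 1)).mul_right).add hac.mul_right).mul_right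
  simp_rw [hL, hR]
  rw [integral_finsetSum _ (fun i _ => hLi i), integral_finsetSum _ (fun i _ => hRi i), ← Finset.sum_neg_distrib]
  exact Finset.sum_congr rfl fun i _ => hIBP i

/-- **Pressure flux against a divergence-free field**: `∫ a·Dp(w) = −∫ p·Da(w)` (`div w = 0`). -/
theorem integral_mul_fderiv_apply_eq_neg_of_divFree {a p : EuclideanSpace ℝ (Fin 3) → ℝ} {w : EuclideanSpace ℝ (Fin 3) → EuclideanSpace ℝ (Fin 3)} (ha : ContDiff ℝ 1 a)
    (hac : HasCompactSupport a) (hp : ContDiff ℝ 1 p) (hw : Differentiable ℝ w)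
    (hwc : ∀ i : Fin 3, Continuous fun x => fderiv ℝ w x (EuclideanSpace.single i 1))
    (hdiv : VectorCalculus.IsDivFree w) :
    ∫ x, a x * fderiv ℝ p x (w x) = - ∫ x, p x * fderiv ℝ a x (w x) := by
  rw [integral_mul_fderiv_apply_eq_neg ha hac hp hw hwc]
  congr 1
  refine integral_congr_ae (ae_of_all _ fun x => ?_)
  simp only [hdiv x, mul_zero, add_zero]

/-- **Gauge-freeness**: `∫ Da(w) = 0` for `a ∈ C¹_c` and a divergence-free `w` (the case `p ≡ 1`). -/
theorem integral_fderiv_apply_eq_zero_of_divFree {a : EuclideanSpace ℝ (Fin 3) → ℝ} {w : EuclideanSpace ℝ (Fin 3) → EuclideanSpace ℝ (Fin 3)} (ha : ContDiff ℝ 1 a)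
    (hac : HasCompactSupport a) (hw : Differentiable ℝ w)
    (hwc : ∀ i : Fin 3, Continuous fun x => fderiv ℝ w x (EuclideanSpace.single i 1))
    (hdiv : VectorCalculus.IsDivFree w) :
    ∫ x, fderiv ℝ a x (w x) = 0 := by
  have h := integral_mul_fderiv_apply_eq_neg_of_divFree ha hac (contDiff_const (c := (1 : ℝ))) hw hwc hdiv
  simp only [fderiv_const_apply, zero_apply, mul_zero, integral_zero, one_mul] at h
  linarith

/-! ## E11 — DOOR-CLASS `Λ(v s)` IS A LEGITIMATE IBP PARTNER: differentiable, continuous partials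
(`∂ᵢΛv = Λ∂ᵢv` is itself differentiable by E6 at order four), divergence free (E8); hence F3's pressure flux
`∫a⟨Dp, Λv(s)⟩ = −∫p⟨Da, Λv(s)⟩` and its gauge-freeness `∫⟨Da, Λv(s)⟩ = 0` for `a ∈ C¹_c`, `p ∈ C¹`. -/

/-- uniform bounds on `f, Df, D²f, D³f` for the directional derivative `y ↦ Dg(y)e` of a `C⁴` field with
`Dg, …, D⁴g` bounded. -/
theorem bounds_fderiv_apply {g : EuclideanSpace ℝ (Fin 3) → EuclideanSpace ℝ (Fin 3)} (hg : ContDiff ℝ 4 g) (e : EuclideanSpace ℝ (Fin 3)) {L₁ L₂ L₃ L₄ : ℝ}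
    (h1 : ∀ y, ‖iteratedFDeriv ℝ 1 g y‖ ≤ L₁) (h2 : ∀ y, ‖iteratedFDeriv ℝ 2 g y‖ ≤ L₂)
    (h3 : ∀ y, ‖iteratedFDeriv ℝ 3 g y‖ ≤ L₃) (h4 : ∀ y, ‖iteratedFDeriv ℝ 4 g y‖ ≤ L₄) :
    ContDiff ℝ 3 (fun y => fderiv ℝ g y e) ∧ (∀ y, ‖fderiv ℝ g y e‖ ≤ ‖e‖ * L₁) ∧
      (∀ y, ‖fderiv ℝ (fun y => fderiv ℝ g y e) y‖ ≤ ‖e‖ * L₂) ∧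
      (∀ y, ‖iteratedFDeriv ℝ 2 (fun y => fderiv ℝ g y e) y‖ ≤ ‖e‖ * L₃) ∧
      (∀ y, ‖iteratedFDeriv ℝ 3 (fun y => fderiv ℝ g y e) y‖ ≤ ‖e‖ * L₄) := by
  have hD : ContDiff ℝ 3 (fderiv ℝ g) := hg.fderiv_right (m := 3) (by norm_cast)
  have hbound : ∀ n : ℕ, n ≤ 3 → ∀ y, ‖iteratedFDeriv ℝ n (fun y => fderiv ℝ g y e) y‖ ≤
      ‖e‖ * ‖iteratedFDeriv ℝ (n + 1) g y‖ := by
    intro n hn y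
    have h := norm_iteratedFDeriv_clm_apply_const (f := fderiv ℝ g) (c := e) (x := y) (n := n)
      (hD.contDiffAt) (by exact_mod_cast hn)
    rwa [norm_iteratedFDeriv_fderiv] at h
  refine ⟨hD.clm_apply contDiff_const, fun y => ?_, fun y => ?_, fun y => ?_, fun y => ?_⟩
  · have h := hbound 0 (by norm_num) y
    rw [norm_iteratedFDeriv_zero] at h
    exact h.trans (mul_le_mul_of_nonneg_left (h1 y) (norm_nonneg e))
  · have h := hbound 1 (by norm_num) y
    rw [norm_iteratedFDeriv_one] at h
    exact h.trans (mul_le_mul_of_nonneg_left (h2 y) (norm_nonneg e))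
  · exact (hbound 2 (by norm_num) y).trans (mul_le_mul_of_nonneg_left (h3 y) (norm_nonneg e))
  · exact (hbound 3 (by norm_num) y).trans (mul_le_mul_of_nonneg_left (h4 y) (norm_nonneg e))

/-- **Regularity of a door-class `Λ(v s)`**: differentiable, with continuous directional derivatives, and
divergence free. -/
theorem fracLapHalf_slice_regular {C D : ℝ} {v : ℝ → EuclideanSpace ℝ (Fin 3) → EuclideanSpace ℝ (Fin 3)} (hrate : HasTypeITimeDecay C v)
    (hdec : HasTypeIDecay D v) (hcont : ContinuousOn (uncurry v) (Iio (0 : ℝ) ×ˢ univ))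
    (hmild : ∀ s t : ℝ, s < t → t < 0 → ∀ x,
      v t x = UnboundedOperators.heatExtension (v s) (t - s) x - oseenDuhamel 1 s v v t x)
    (hdiv : ∀ t < 0, VectorCalculus.IsDivFree (v t)) {s : ℝ} (hs : s < 0) :
    Differentiable ℝ (fracLapHalf (v s)) ∧
      (∀ e : EuclideanSpace ℝ (Fin 3), Continuous fun x => fderiv ℝ (fracLapHalf (v s)) x e) ∧
      VectorCalculus.IsDivFree (fracLapHalf (v s)) := by
  obtain ⟨Q, hsol, hSIB⟩ := exists_classical_scaleInvariantBounds_of_class hrate hdec hcont hmild hdiv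
  have hcd4 : ContDiff ℝ 4 (v s) :=
    (hsol.contDiff_velocity (show s ∈ Iio (0 : ℝ) from hs)).of_le (by norm_cast)
  have hcd : ContDiff ℝ 3 (v s) := hcd4.of_le (by norm_cast)
  have hsq : 0 < Real.sqrt (-s) := Real.sqrt_pos.2 (neg_pos.2 hs)
  have hbd : ∀ n : ℕ, ∃ M : ℝ, ∀ y : EuclideanSpace ℝ (Fin 3), ‖iteratedFDeriv ℝ n (v s) y‖ ≤ M := by
    intro n
    obtain ⟨L, hL⟩ := hSIB n
    refine ⟨|L| / Real.sqrt (-s) ^ (1 + n), fun y => ?_⟩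
    have hden : 0 < (‖y‖ + Real.sqrt (-s)) ^ (1 + n) := by positivity
    calc ‖iteratedFDeriv ℝ n (v s) y‖ ≤ L / (‖y‖ + Real.sqrt (-s)) ^ (1 + n) := (hL s hs y).1
      _ ≤ |L| / (‖y‖ + Real.sqrt (-s)) ^ (1 + n) := div_le_div_of_nonneg_right (le_abs_self L) hden.le
      _ ≤ |L| / Real.sqrt (-s) ^ (1 + n) := by
          apply div_le_div_of_nonneg_left (abs_nonneg L) (by positivity)
          exact pow_le_pow_left₀ hsq.le (le_add_of_nonneg_left (norm_nonneg y)) _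
  obtain ⟨M₀, hM₀⟩ := hbd 0
  obtain ⟨M₁, hM₁⟩ := hbd 1
  obtain ⟨M₂, hM₂⟩ := hbd 2
  obtain ⟨M₃, hM₃⟩ := hbd 3
  obtain ⟨M₄, hM₄⟩ := hbd 4
  have h0 : ∀ y, ‖v s y‖ ≤ M₀ := fun y => by have := hM₀ y; rwa [norm_iteratedFDeriv_zero] at this
  have h1 : ∀ y, ‖fderiv ℝ (v s) y‖ ≤ M₁ := fun y => by have := hM₁ y; rwa [norm_iteratedFDeriv_one] at this
  refine ⟨fun x => (hasFDerivAt_fracLapHalf hcd h0 h1 hM₂ hM₃ x).differentiableAt, fun e => ?_,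
    isDivFree_fracLapHalf_slice hrate hdec hcont hmild hdiv hs⟩
  -- `x ↦ D(Λv)(x)e = Λ(Dv·e)(x)` is differentiable (E6 at order four), hence continuous
  obtain ⟨hg3, g0, g1, g2, g3⟩ := bounds_fderiv_apply hcd4 e hM₁ hM₂ hM₃ hM₄
  have heq : (fun x => fderiv ℝ (fracLapHalf (v s)) x e) = fracLapHalf (fun y => fderiv ℝ (v s) y e) := by
    funext x; exact fderiv_fracLapHalf_apply hcd h0 h1 hM₂ hM₃ x e
  rw [heq]
  exact continuous_iff_continuousAt.2 fun x =>
    (hasFDerivAt_fracLapHalf hg3 g0 g1 g2 g3 x).differentiableAt.continuousAt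

/-- **F3's pressure flux in the door class**: `∫ a·Dp(Λv(s)) = −∫ p·Da(Λv(s))` for `a ∈ C¹_c`, `p ∈ C¹`, `s < 0`. -/
theorem integral_mul_fderiv_apply_fracLapHalf_slice {C D : ℝ} {v : ℝ → EuclideanSpace ℝ (Fin 3) → EuclideanSpace ℝ (Fin 3)} (hrate : HasTypeITimeDecay C v)
    (hdec : HasTypeIDecay D v) (hcont : ContinuousOn (uncurry v) (Iio (0 : ℝ) ×ˢ univ))
    (hmild : ∀ s t : ℝ, s < t → t < 0 → ∀ x,
      v t x = UnboundedOperators.heatExtension (v s) (t - s) x - oseenDuhamel 1 s v v t x)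
    (hdiv : ∀ t < 0, VectorCalculus.IsDivFree (v t)) {s : ℝ} (hs : s < 0) {a p : EuclideanSpace ℝ (Fin 3) → ℝ}
    (ha : ContDiff ℝ 1 a) (hac : HasCompactSupport a) (hp : ContDiff ℝ 1 p) :
    ∫ x, a x * fderiv ℝ p x (fracLapHalf (v s) x) = - ∫ x, p x * fderiv ℝ a x (fracLapHalf (v s) x) := by
  obtain ⟨hd, hc, hdf⟩ := fracLapHalf_slice_regular hrate hdec hcont hmild hdiv hs
  exact integral_mul_fderiv_apply_eq_neg_of_divFree ha hac hp hd (fun i => hc _) hdf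

/-- **Gauge-freeness of F3's pressure flux in the door class**: `∫ Da(Λv(s)) = 0` for `a ∈ C¹_c`, `s < 0`. -/
theorem integral_fderiv_apply_fracLapHalf_slice_eq_zero {C D : ℝ} {v : ℝ → EuclideanSpace ℝ (Fin 3) → EuclideanSpace ℝ (Fin 3)}
    (hrate : HasTypeITimeDecay C v) (hdec : HasTypeIDecay D v)
    (hcont : ContinuousOn (uncurry v) (Iio (0 : ℝ) ×ˢ univ))
    (hmild : ∀ s t : ℝ, s < t → t < 0 → ∀ x,
      v t x = UnboundedOperators.heatExtension (v s) (t - s) x - oseenDuhamel 1 s v v t x)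
    (hdiv : ∀ t < 0, VectorCalculus.IsDivFree (v t)) {s : ℝ} (hs : s < 0) {a : EuclideanSpace ℝ (Fin 3) → ℝ}
    (ha : ContDiff ℝ 1 a) (hac : HasCompactSupport a) :
    ∫ x, fderiv ℝ a x (fracLapHalf (v s) x) = 0 := by
  obtain ⟨hd, hc, hdf⟩ := fracLapHalf_slice_regular hrate hdec hcont hmild hdiv hs
  exact integral_fderiv_apply_eq_zero_of_divFree ha hac hd (fun i => hc _) hdf

end Summit.NavierStokesRegularity.NavierStokesRegularity.Theorems.CriticalFluxDoorPressureIBP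

end
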